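import Mathlib
import Literature.Analysis.FluidPDE.LoopCirculation
import Literature.Analysis.FluidPDE.VorticityCalculus
import Summits.NavierStokesRegularity.NavierStokesRegularity.Theorems.TautLoopKelvinTautLoopLawLevelLeftContinuityTools
import HarnessLib

/-!
# Route `TautLoopKelvin`, crux `TautLoopLaw` (stmt-NavierStokesRegularity-15249), line
  `Sketch-ideas-r1k1` — tools for `stub_tautLoopLevelLeftContinuity`, part 2: the lasso

The **lasso** of a closed `C¹` loop `γ` and a planar circle (`tautLoopLlc_lasso`): `γ` stopped at
`γ a`, a straight tether to the circle, once around, and back, glued with zero velocity at the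
junctions; `∮ = ∮_γ + ∮_circle`, `len ≤ len γ + π ‖c + r e₁ - γ a‖ + len circle`. With a coordinate
frame oriented by the vorticity (`tautLoopLlc_frame`) and Stokes on discs
(`circulation_circleLoop_eq_integral_curl`) a small circle near a point with `‖curl v‖ ≥ w` gains a
definite circulation at small cost of length (`tautLoopLlc_lasso_gain`). Folklore; all proved.
-/

noncomputable section

open Set MeasureTheory Filter Topology Function Real intervalIntegral Metric
  Literature.Analysis.FluidPDE
open scoped InnerProductSpace RealInnerProductSpace

namespace Summit.NavierStokesRegularity.NavierStokesRegularity.Theorems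

set_option linter.dupNamespace false

local notation3 "E3" => EuclideanSpace ℝ (Fin 3)

local notation3 (prettyPrint := false) "glue⟦" α ", " β "⟧" =>
  (fun s : ℝ => if Real.sin (2 * Real.pi * s) ≤ 0 then β (2 * s) else α (2 * s))

local notation3 (prettyPrint := false) "seg⟦" p ", " q "⟧" =>
  (fun s : ℝ => p + ((1 - Real.cos (2 * Real.pi * s)) / 2) • (q - p))

/-! ## The there-and-back tether -/

/-- An integral over `[0, 1]` of a function bounded by `C` is at most `C`. [folklore] -/
theorem tautLoopLlc_integral_le_of_le {f : ℝ → ℝ} {C : ℝ} (h0 : ∀ s, 0 ≤ f s) (hC : ∀ s, f s ≤ C) :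
    ∫ s in (0:ℝ)..1, f s ≤ C :=
  calc ∫ s in (0:ℝ)..1, f s ≤ ‖∫ s in (0:ℝ)..1, f s‖ := Real.le_norm_self _
    _ ≤ C * |1 - 0| := intervalIntegral.norm_integral_le_of_norm_le_const fun s _ => by
        rw [Real.norm_eq_abs, abs_of_nonneg (h0 s)]
        exact hC s
    _ = C := by simp

/-- Velocity of the tether `s ↦ p + ((1 - cos 2πs)/2) (q - p)`. [folklore] -/
theorem tautLoopLlc_hasDerivAt_seg (p q : E3) (s : ℝ) :
    HasDerivAt (seg⟦p, q⟧) ((π * Real.sin (2 * π * s)) • (q - p)) s := by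
  have hθ : HasDerivAt (fun s : ℝ => 2 * π * s) (2 * π) s := by
    simpa using (hasDerivAt_id s).const_mul (2 * π)
  have hcos : HasDerivAt (fun s : ℝ => (1 - Real.cos (2 * π * s)) / 2)
      ((0 - (-Real.sin (2 * π * s) * (2 * π))) / 2) s :=
    ((hasDerivAt_const s (1:ℝ)).sub ((Real.hasDerivAt_cos _).comp s hθ)).div_const 2
  have h := (hcos.smul_const (q - p)).const_add p
  refine h.congr_deriv ?_
  congr 1
  ring

/-- The tether is a `C¹` loop (in fact smooth and `1`-periodic) resting at `p` at time `0` and at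
`q` at time `1/2`. [folklore] -/
theorem tautLoopLlc_seg_isC1Loop (p q : E3) :
    IsC1Loop (seg⟦p, q⟧) ∧ (seg⟦p, q⟧) 0 = p ∧ (seg⟦p, q⟧) (1/2) = q ∧
      deriv (seg⟦p, q⟧) 0 = 0 ∧ deriv (seg⟦p, q⟧) (1/2) = 0 := by
  refine ⟨⟨by fun_prop, fun s => ?_⟩, by simp, ?_, ?_, ?_⟩
  · show p + ((1 - Real.cos (2 * π * (s + 1))) / 2) • (q - p) =
      p + ((1 - Real.cos (2 * π * s)) / 2) • (q - p)
    rw [show 2 * π * (s + 1) = 2 * π * s + 2 * π by ring, Real.cos_add_two_pi]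
  · show p + ((1 - Real.cos (2 * π * (1/2))) / 2) • (q - p) = q
    rw [show 2 * π * (1/2 : ℝ) = π by ring, Real.cos_pi, show ((1:ℝ) - -1) / 2 = 1 by norm_num,
      one_smul, add_sub_cancel]
  · rw [(tautLoopLlc_hasDerivAt_seg p q 0).deriv]
    simp
  · rw [(tautLoopLlc_hasDerivAt_seg p q (1/2)).deriv, show 2 * π * (1/2 : ℝ) = π by ring,
      Real.sin_pi]
    simp

/-- The tether, traversed there and back, has zero circulation (it is invariant under the
orientation reversal `s ↦ 1 - s`, which flips the sign of the circulation). [folklore] -/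
theorem tautLoopLlc_seg_circulation (v : E3 → E3) (p q : E3) :
    circulation v (seg⟦p, q⟧) = 0 := by
  have hsymm : (fun s => (seg⟦p, q⟧) (1 - s)) = seg⟦p, q⟧ := by
    funext s
    simp only
    rw [show 2 * π * (1 - s) = 2 * π - 2 * π * s by ring, Real.cos_two_pi_sub]
  have h := circulation_comp_one_sub v (seg⟦p, q⟧)
  rw [hsymm] at h
  linarith

/-- The tether has length at most `π ‖q - p‖`. [folklore] -/
theorem tautLoopLlc_seg_len (p q : E3) :
    ∫ s in (0:ℝ)..1, ‖deriv (seg⟦p, q⟧) s‖ ≤ π * ‖q - p‖ := by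
  have hb : ∀ s, ‖deriv (seg⟦p, q⟧) s‖ ≤ π * ‖q - p‖ := fun s => by
    rw [(tautLoopLlc_hasDerivAt_seg p q s).deriv, norm_smul, Real.norm_eq_abs, abs_mul,
      abs_of_pos Real.pi_pos]
    exact mul_le_mul_of_nonneg_right (mul_le_of_le_one_right Real.pi_pos.le
      (Real.abs_sin_le_one _)) (norm_nonneg _)
  exact tautLoopLlc_integral_le_of_le (fun s => norm_nonneg _) hb

/-! ## Planar circles: length and orientation -/

/-- A planar circle on a frame of unit vectors has length at most `4π|r|`. [folklore] -/
theorem tautLoopLlc_circle_len {e₁ e₂ : E3} (h1 : ‖e₁‖ = 1) (h2 : ‖e₂‖ = 1) (c : E3) (r : ℝ) :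
    ∫ s in (0:ℝ)..1, ‖deriv (circleLoop c r e₁ e₂) s‖ ≤ 4 * π * |r| := by
  have hb : ∀ s, ‖deriv (circleLoop c r e₁ e₂) s‖ ≤ 4 * π * |r| := fun s => by
    rw [deriv_circleLoop, norm_smul, Real.norm_eq_abs,
      abs_of_pos (by positivity : (0:ℝ) < 2 * π)]
    have : ‖(-(r * Real.sin (2 * π * s))) • e₁ + (r * Real.cos (2 * π * s)) • e₂‖ ≤ |r| + |r| := by
      refine (norm_add_le _ _).trans (add_le_add ?_ ?_)
      · rw [norm_smul, h1, mul_one, Real.norm_eq_abs, abs_neg, abs_mul]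
        exact mul_le_of_le_one_right (abs_nonneg _) (Real.abs_sin_le_one _)
      · rw [norm_smul, h2, mul_one, Real.norm_eq_abs, abs_mul]
        exact mul_le_of_le_one_right (abs_nonneg _) (Real.abs_cos_le_one _)
    nlinarith [Real.pi_pos, abs_nonneg r]
  exact tautLoopLlc_integral_le_of_le (fun s => norm_nonneg _) hb

/-- Reversing the second frame vector reverses the orientation of the circle and the sign of the
circulation. [folklore] -/
theorem tautLoopLlc_circulation_circle_neg (v : E3 → E3) (c e₁ e₂ : E3) (r : ℝ) :
    circulation v (circleLoop c r e₁ (-e₂)) = -circulation v (circleLoop c r e₁ e₂) := by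
  have h : (fun s => circleLoop c r e₁ e₂ (1 - s)) = circleLoop c r e₁ (-e₂) := by
    funext s
    simp only [circleLoop]
    rw [show 2 * π * (1 - s) = 2 * π - 2 * π * s by ring, Real.cos_two_pi_sub,
      Real.sin_two_pi_sub]
    simp [neg_smul]
  rw [← h, circulation_comp_one_sub]

/-! ## The lasso -/

/-- **The lasso.** For a continuous field `v`, a closed `C¹` loop `γ`, a parameter `a` and a planar
circle `circleLoop c r e₁ e₂`, there is a closed `C¹` loop `Λ` — `γ` reparametrised to stop at
`γ a`, a straight tether to the point `c + r e₁` of the circle, once around the circle (stopping at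
`c + r e₁`), and back along the tether, all glued with zero velocity at the junctions — with
`∮_Λ v = ∮_γ v + ∮_circle v` and `len Λ ≤ len γ + π ‖c + r e₁ - γ a‖ + len circle`. [folklore] -/
theorem tautLoopLlc_lasso {v : E3 → E3} (hv : Continuous v) {γ : ℝ → E3} (hγ : IsC1Loop γ)
    (a : ℝ) (c e₁ e₂ : E3) (r : ℝ) :
    ∃ Λ : ℝ → E3, IsC1Loop Λ ∧
      circulation v Λ = circulation v γ + circulation v (circleLoop c r e₁ e₂) ∧
      ∫ s in (0:ℝ)..1, ‖deriv Λ s‖ ≤ (∫ s in (0:ℝ)..1, ‖deriv γ s‖) +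
        π * ‖c + r • e₁ - γ a‖ + ∫ s in (0:ℝ)..1, ‖deriv (circleLoop c r e₁ e₂) s‖ := by
  obtain ⟨hγ₁, hγ₁0, hγ₁d⟩ := tautLoopLlc_stop_isC1Loop hγ a
  have hγ₁c := tautLoopLlc_stop_circulation v hγ a
  have hγ₁l := tautLoopLlc_stop_len hγ a
  set γ₁ : ℝ → E3 := fun s => γ (a + (s - Real.sin (2 * π * s) / (2 * π))) with hγ₁_def
  have hC := isC1Loop_circleLoop c r e₁ e₂
  obtain ⟨hC₁, hC₁0, hC₁d⟩ := tautLoopLlc_stop_isC1Loop hC 0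
  have hC₁c := tautLoopLlc_stop_circulation v hC 0
  have hC₁l := tautLoopLlc_stop_len hC 0
  set C₁ : ℝ → E3 := fun s => circleLoop c r e₁ e₂ (0 + (s - Real.sin (2 * π * s) / (2 * π)))
    with hC₁_def
  set p : E3 := γ a with hp
  set q : E3 := c + r • e₁ with hq
  have hq0 : circleLoop c r e₁ e₂ 0 = q := by simp [circleLoop, hq]
  obtain ⟨hσ, hσ0, hσh, hσd0, hσdh⟩ := tautLoopLlc_seg_isC1Loop p q
  have hσc := tautLoopLlc_seg_circulation v p q
  have hσl := tautLoopLlc_seg_len p q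
  set σ : ℝ → E3 := seg⟦p, q⟧ with hσ_def
  set σ' : ℝ → E3 := fun s => σ (s + 1/2) with hσ'_def
  have hσ' : IsC1Loop σ' := hσ.comp_add_const (1/2)
  have hσ'0 : σ' 0 = q := by rw [← hσh]; exact congrArg σ (zero_add _)
  have hσ'd : deriv σ' 0 = 0 := by
    rw [← hσdh, hσ'_def, deriv_comp_add_const, zero_add]
  -- the excursion `κ`: circle then tether, based at `q`; it rests at `p` at time `-1/4`
  have hk0 : C₁ 0 = σ' 0 := by rw [hC₁0, hq0, hσ'0]
  have hκ := tautLoopLlc_glue_isC1Loop hC₁ hσ' hk0 hC₁d hσ'd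
  have hκd := tautLoopLlc_glue_hasDerivAt hC₁ hσ' hk0 hC₁d hσ'd
  have hκc := tautLoopLlc_glue_circulation hv hC₁ hσ' hk0 hC₁d hσ'd
  have hκl := tautLoopLlc_glue_len hC₁ hσ' hk0 hC₁d hσ'd
  set κ : ℝ → E3 := glue⟦C₁, σ'⟧ with hκ_def
  have hsin : Real.sin (2 * π * (-1/4 : ℝ)) = -1 := by
    rw [show 2 * π * (-1/4 : ℝ) = -(π/2) by ring, Real.sin_neg, Real.sin_pi_div_two]
  have hκv : κ (-1/4) = p := by
    show (if Real.sin (2 * π * (-1/4 : ℝ)) ≤ 0 then σ' (2 * (-1/4)) else C₁ (2 * (-1/4))) = p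
    rw [hsin, if_pos (by norm_num)]
    show σ (2 * (-1/4) + 1/2) = p
    rw [show (2:ℝ) * (-1/4) + 1/2 = 0 by norm_num, hσ0]
  have hκd4 : deriv κ (-1/4) = 0 := by
    rw [(hκd (-1/4)).deriv, hsin, if_pos (by norm_num)]
    show (2:ℝ) • deriv (fun s => σ (s + 1/2)) (2 * (-1/4)) = 0
    rw [deriv_comp_add_const, show (2:ℝ) * (-1/4) + 1/2 = 0 by norm_num, hσd0, smul_zero]
  set κ' : ℝ → E3 := fun s => κ (s + (-1/4)) with hκ'_def
  have hκ' : IsC1Loop κ' := hκ.comp_add_const _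
  have hκ'0 : κ' 0 = p := by rw [← hκv]; exact congrArg κ (zero_add _)
  have hκ'd : deriv κ' 0 = 0 := by
    rw [← hκd4, hκ'_def, deriv_comp_add_const, zero_add]
  have hκ'c : circulation v κ' = circulation v κ := circulation_comp_add_const v hκ.periodic _
  have hκ'l : ∫ s in (0:ℝ)..1, ‖deriv κ' s‖ = ∫ s in (0:ℝ)..1, ‖deriv κ s‖ :=
    tautLoopLlc_len_comp_add_const hκ.periodic _
  have hσ'c : circulation v σ' = circulation v σ := circulation_comp_add_const v hσ.periodic _
  have hσ'l : ∫ s in (0:ℝ)..1, ‖deriv σ' s‖ = ∫ s in (0:ℝ)..1, ‖deriv σ s‖ :=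
    tautLoopLlc_len_comp_add_const hσ.periodic _
  -- the lasso `Λ`: the loop then the excursion, based at `p`
  have hl0 : γ₁ 0 = κ' 0 := by rw [hγ₁0, hκ'0]
  refine ⟨glue⟦γ₁, κ'⟧, tautLoopLlc_glue_isC1Loop hγ₁ hκ' hl0 hγ₁d hκ'd, ?_, ?_⟩
  · rw [tautLoopLlc_glue_circulation hv hγ₁ hκ' hl0 hγ₁d hκ'd, hγ₁c, hκ'c, hκc, hC₁c, hσ'c, hσc,
      add_zero]
  · rw [tautLoopLlc_glue_len hγ₁ hκ' hl0 hγ₁d hκ'd, hγ₁l, hκ'l, hκl, hC₁l, hσ'l]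
    have hqp : ‖q - p‖ = ‖c + r • e₁ - γ a‖ := by rw [hq, hp]
    rw [← hqp]
    linarith

/-! ## Frames adapted to a vector -/

/-- Cross products of the standard basis vectors of `ℝ³`. [folklore] -/
theorem tautLoopLlc_cross_single :
    cross (EuclideanSpace.single 0 (1:ℝ)) (EuclideanSpace.single 1 1) = EuclideanSpace.single 2 1 ∧
    cross (EuclideanSpace.single 1 (1:ℝ)) (EuclideanSpace.single 2 1) = EuclideanSpace.single 0 1 ∧
    cross (EuclideanSpace.single 2 (1:ℝ)) (EuclideanSpace.single 0 1) = EuclideanSpace.single 1 1 := by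
  refine ⟨?_, ?_, ?_⟩ <;> ext i <;> fin_cases i <;> simp [cross, cross_apply]

/-- Some coordinate of a vector of `ℝ³` has absolute value at least half its norm. [folklore] -/
theorem tautLoopLlc_exists_coord (u : E3) : ∃ i : Fin 3, ‖u‖ / 2 ≤ |u i| := by
  by_contra h
  push Not at h
  have hsq : ∀ i, (u i) ^ 2 < (‖u‖ / 2) ^ 2 := fun i => by
    rw [← sq_abs]
    exact pow_lt_pow_left₀ (h i) (abs_nonneg _) two_ne_zero
  have hn : ‖u‖ ^ 2 = (u 0) ^ 2 + (u 1) ^ 2 + (u 2) ^ 2 := by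
    rw [EuclideanSpace.norm_sq_eq, Fin.sum_univ_three]
    simp [Real.norm_eq_abs, sq_abs]
  nlinarith [hsq 0, hsq 1, hsq 2, norm_nonneg u]

/-- **A frame adapted to a vector.** For every `u ∈ ℝ³` there are unit vectors `e₁`, `e₂` with
`e₁ × e₂` a unit vector and `⟪u, e₁ × e₂⟫ ≥ ‖u‖/2` (a suitably oriented coordinate frame). [folklore] -/
theorem tautLoopLlc_frame (u : E3) :
    ∃ e₁ e₂ : E3, ‖e₁‖ = 1 ∧ ‖e₂‖ = 1 ∧ ‖cross e₁ e₂‖ = 1 ∧ ‖u‖ / 2 ≤ ⟪u, cross e₁ e₂⟫ := by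
  obtain ⟨hc0, hc1, hc2⟩ := tautLoopLlc_cross_single
  have hfr : ∀ i : Fin 3, ∃ e₁ e₂ : E3, ‖e₁‖ = 1 ∧ ‖e₂‖ = 1 ∧
      cross e₁ e₂ = EuclideanSpace.single i 1 := by
    intro i
    fin_cases i
    · exact ⟨_, _, by simp, by simp, hc1⟩
    · exact ⟨_, _, by simp, by simp, hc2⟩
    · exact ⟨_, _, by simp, by simp, hc0⟩
  obtain ⟨i, hi⟩ := tautLoopLlc_exists_coord u
  obtain ⟨e₁, e₂, h1, h2, h12⟩ := hfr i
  have hswap : cross e₂ e₁ = -cross e₁ e₂ := by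
    simp only [cross]
    rw [← cross_anticomm, WithLp.toLp_neg]
  have hn : ‖EuclideanSpace.single i (1:ℝ)‖ = 1 := by simp
  have hinner : ⟪u, EuclideanSpace.single i (1:ℝ)⟫ = u i := by
    simp [EuclideanSpace.inner_single_right]
  rcases le_or_gt 0 (u i) with hpos | hneg
  · refine ⟨e₁, e₂, h1, h2, by rw [h12, hn], ?_⟩
    rw [h12, hinner]
    rwa [abs_of_nonneg hpos] at hi
  · refine ⟨e₂, e₁, h2, h1, by rw [hswap, h12, norm_neg, hn], ?_⟩
    rw [hswap, h12, inner_neg_right, hinner]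
    rwa [abs_of_neg hneg] at hi

/-! ## The gain of a small circle -/

/-- **Gain of a small circle.** If `⟪curl v, e₁ × e₂⟫ ≥ w` on the ball of radius `2r` about `c`
(`e₁`, `e₂` unit vectors, `r ≥ 0`), the circulation of the `C¹` field `v` around
`circleLoop c r e₁ e₂` is at least `π r² w` (Stokes on the disc,
`circulation_circleLoop_eq_integral_curl`). [folklore] -/
theorem tautLoopLlc_circle_gain {v : E3 → E3} (hv : ContDiff ℝ 1 v) {c e₁ e₂ : E3}
    (h1 : ‖e₁‖ = 1) (h2 : ‖e₂‖ = 1) {r w : ℝ} (hr : 0 ≤ r)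
    (hw : ∀ y, dist y c ≤ 2 * r → w ≤ ⟪curl v y, cross e₁ e₂⟫) :
    π * r ^ 2 * w ≤ circulation v (circleLoop c r e₁ e₂) := by
  rw [circulation_circleLoop_eq_integral_curl hv]
  set f : ℝ → ℝ → ℝ := fun ρ θ =>
    ρ * ⟪curl v (c + (ρ * Real.cos θ) • e₁ + (ρ * Real.sin θ) • e₂), cross e₁ e₂⟫ with hf
  have hcont : Continuous (Function.uncurry f) := by
    have hc := continuous_curl hv
    have hP : Continuous fun q : ℝ × ℝ =>
        c + (q.1 * Real.cos q.2) • e₁ + (q.1 * Real.sin q.2) • e₂ := by fun_prop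
    exact continuous_fst.mul ((hc.comp hP).inner continuous_const)
  have hpt : ∀ ρ ∈ Icc 0 r, ∀ θ, ρ * w ≤ f ρ θ := by
    intro ρ hρ θ
    refine mul_le_mul_of_nonneg_left (hw _ ?_) hρ.1
    rw [dist_eq_norm, show c + (ρ * Real.cos θ) • e₁ + (ρ * Real.sin θ) • e₂ - c =
      (ρ * Real.cos θ) • e₁ + (ρ * Real.sin θ) • e₂ by abel]
    refine (norm_add_le _ _).trans ?_
    rw [norm_smul, norm_smul, h1, h2, mul_one, mul_one, Real.norm_eq_abs, Real.norm_eq_abs,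
      abs_mul, abs_mul, abs_of_nonneg hρ.1]
    nlinarith [Real.abs_cos_le_one θ, Real.abs_sin_le_one θ, hρ.1, hρ.2,
      abs_nonneg (Real.cos θ), abs_nonneg (Real.sin θ)]
  have hinner : ∀ ρ ∈ Icc 0 r, 2 * π * (ρ * w) ≤ ∫ θ in (0:ℝ)..2 * π, f ρ θ := by
    intro ρ hρ
    have h2π : (0:ℝ) ≤ 2 * π := by positivity
    calc 2 * π * (ρ * w) = ∫ _ in (0:ℝ)..2 * π, ρ * w := by
          rw [intervalIntegral.integral_const, sub_zero, smul_eq_mul]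
      _ ≤ ∫ θ in (0:ℝ)..2 * π, f ρ θ :=
          intervalIntegral.integral_mono_on h2π intervalIntegrable_const
            ((hcont.comp (continuous_const.prodMk continuous_id)).intervalIntegrable _ _)
            (fun θ _ => hpt ρ hρ θ)
  calc π * r ^ 2 * w = ∫ ρ in (0:ℝ)..r, 2 * π * (ρ * w) := by
        rw [show (fun ρ : ℝ => 2 * π * (ρ * w)) = fun ρ : ℝ => ρ * (2 * π * w) by
          funext ρ; ring, intervalIntegral.integral_mul_const, integral_id]
        ring
    _ ≤ ∫ ρ in (0:ℝ)..r, ∫ θ in (0:ℝ)..2 * π, f ρ θ :=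
        intervalIntegral.integral_mono_on hr
          ((by fun_prop : Continuous fun ρ : ℝ => 2 * π * (ρ * w)).intervalIntegrable _ _)
          ((intervalIntegral.continuous_parametric_intervalIntegral_of_continuous' hcont 0
            (2 * π)).intervalIntegrable _ _)
          (fun ρ hρ => hinner ρ hρ)

/-! ## Case B1 of the stub: vorticity near the loop pays for the level deficit -/

/-- **The lasso gain.** Let `v` be `C²`. Given a radius `R₀`, a distance `d`, a vorticity
threshold `w > 0` and a length budget `τ > 0`, there is a gain `G₀ > 0` such that every closed `C¹`
loop `γ` inside the ball of radius `R₀` having a point `x` with `‖curl v x‖ ≥ w` within distance `d`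
of `γ` can be modified into a closed `C¹` loop `Λ` with `|∮_Λ v| ≥ |∮_γ v| + G₀` and
`len Λ ≤ len γ + π d + τ` (a lasso through a small circle about `x` in the plane normal to a
coordinate direction of large vorticity, oriented by the sign of `∮_γ v`; the radius is chosen from
the modulus of continuity of `curl v` on a compact ball, uniformly in the loop). [folklore] -/
theorem tautLoopLlc_lasso_gain {v : E3 → E3} (hv : ContDiff ℝ 2 v) (R₀ d w τ : ℝ)
    (hw : 0 < w) (hτ : 0 < τ) :
    ∃ G₀ : ℝ, 0 < G₀ ∧ ∀ γ : ℝ → E3, IsC1Loop γ → (∀ s, ‖γ s‖ ≤ R₀) →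
      ∀ (x : E3) (s : ℝ), dist x (γ s) ≤ d → w ≤ ‖curl v x‖ →
        ∃ Λ : ℝ → E3, IsC1Loop Λ ∧ |circulation v γ| + G₀ ≤ |circulation v Λ| ∧
          ∫ σ in (0:ℝ)..1, ‖deriv Λ σ‖ ≤ (∫ σ in (0:ℝ)..1, ‖deriv γ σ‖) + π * d + τ := by
  have hv1 : ContDiff ℝ 1 v := hv.of_le one_le_two
  have hvc : Continuous v := hv.continuous
  have hcurl : Continuous (curl v) := continuous_curl hv1
  obtain ⟨ρ₀, hρ₀, hUC⟩ : ∃ ρ₀ > 0, ∀ x ∈ closedBall (0:E3) (R₀ + d + 1),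
      ∀ y ∈ closedBall (0:E3) (R₀ + d + 1), dist x y < ρ₀ →
        dist (curl v x) (curl v y) < w / 4 :=
    Metric.uniformContinuousOn_iff.1
      ((isCompact_closedBall (0:E3) (R₀ + d + 1)).uniformContinuousOn_of_continuous
        hcurl.continuousOn) (w / 4) (by positivity)
  set r : ℝ := min (ρ₀ / 4) (min (1 / 4) (τ / 20)) with hr_def
  have hr0 : 0 < r := lt_min (by positivity) (lt_min (by positivity) (by positivity))
  have hrρ : r ≤ ρ₀ / 4 := min_le_left _ _
  have hr1 : r ≤ 1 / 4 ∧ r ≤ τ / 20 := le_min_iff.1 (min_le_right _ _)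
  have hG₀ : 0 < π * r ^ 2 * (w / 4) := by positivity
  refine ⟨π * r ^ 2 * (w / 4), hG₀, ?_⟩
  intro γ hγ hR x s hxs hwx
  obtain ⟨e₁, e₂, he₁, he₂, hn, hun⟩ := tautLoopLlc_frame (curl v x)
  have hx : ‖x‖ ≤ R₀ + d := by
    linarith [hR s, dist_zero_right x ▸ dist_zero_right (γ s) ▸ dist_triangle x (γ s) 0]
  -- `⟪curl v y, e₁ × e₂⟫ ≥ w/4` on the ball of radius `2r` about `x`
  have hnear : ∀ y, dist y x ≤ 2 * r → w / 4 ≤ ⟪curl v y, cross e₁ e₂⟫ := by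
    intro y hy
    have hyx : ‖y‖ ≤ ‖x‖ + 2 * r := by
      linarith [dist_zero_right y ▸ dist_zero_right x ▸ dist_triangle y x 0]
    have hyB : y ∈ closedBall (0:E3) (R₀ + d + 1) := by
      rw [mem_closedBall, dist_zero_right]; linarith [hr1.1]
    have hxB : x ∈ closedBall (0:E3) (R₀ + d + 1) := by
      rw [mem_closedBall, dist_zero_right]; linarith
    have hdist : dist (curl v y) (curl v x) < w / 4 := hUC y hyB x hxB (by linarith)
    rw [dist_eq_norm] at hdist
    have h1 : ⟪curl v y, cross e₁ e₂⟫ =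
        ⟪curl v x, cross e₁ e₂⟫ + ⟪curl v y - curl v x, cross e₁ e₂⟫ := by
      rw [inner_sub_left]; ring
    have h2 : |⟪curl v y - curl v x, cross e₁ e₂⟫| ≤ ‖curl v y - curl v x‖ * ‖cross e₁ e₂‖ :=
      abs_real_inner_le_norm _ _
    rw [hn, mul_one] at h2
    have h3 := neg_abs_le ⟪curl v y - curl v x, cross e₁ e₂⟫
    linarith
  have hG : π * r ^ 2 * (w / 4) ≤ circulation v (circleLoop x r e₁ e₂) :=
    tautLoopLlc_circle_gain hv1 he₁ he₂ hr0.le hnear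
  have hG' : circulation v (circleLoop x r e₁ (-e₂)) ≤ -(π * r ^ 2 * (w / 4)) := by
    rw [tautLoopLlc_circulation_circle_neg]; linarith
  have hqp : ‖x + r • e₁ - γ s‖ ≤ d + r := by
    calc ‖x + r • e₁ - γ s‖ = ‖(x - γ s) + r • e₁‖ := by congr 1; abel
      _ ≤ ‖x - γ s‖ + ‖r • e₁‖ := norm_add_le _ _
      _ ≤ d + r := by
          rw [norm_smul, he₁, mul_one, Real.norm_eq_abs, abs_of_pos hr0, ← dist_eq_norm]
          linarith
  have hcl : ∫ σ in (0:ℝ)..1, ‖deriv (circleLoop x r e₁ e₂) σ‖ ≤ 4 * π * r := by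
    have h := tautLoopLlc_circle_len he₁ he₂ x r
    rwa [abs_of_pos hr0] at h
  have hcl' : ∫ σ in (0:ℝ)..1, ‖deriv (circleLoop x r e₁ (-e₂)) σ‖ ≤ 4 * π * r := by
    have h := tautLoopLlc_circle_len he₁ (by rw [norm_neg, he₂]) x r
    rwa [abs_of_pos hr0] at h
  have hbudget : π * (d + r) + 4 * π * r ≤ π * d + τ := by
    nlinarith [Real.pi_pos, Real.pi_le_four, hr1.2]
  have hπ : π * ‖x + r • e₁ - γ s‖ ≤ π * (d + r) := mul_le_mul_of_nonneg_left hqp Real.pi_pos.le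
  rcases le_or_gt 0 (circulation v γ) with hpos | hneg
  · obtain ⟨Λ, hΛ, hΛc, hΛl⟩ := tautLoopLlc_lasso hvc hγ s x e₁ e₂ r
    refine ⟨Λ, hΛ, ?_, by linarith⟩
    rw [hΛc, abs_of_nonneg hpos, abs_of_nonneg (by linarith)]
    linarith
  · obtain ⟨Λ, hΛ, hΛc, hΛl⟩ := tautLoopLlc_lasso hvc hγ s x e₁ (-e₂) r
    refine ⟨Λ, hΛ, ?_, by linarith⟩
    rw [hΛc, abs_of_neg hneg, abs_of_neg (by linarith)]
    linarith

/-- **Tools stub, part 2** (registered as `stub_tautLoopLlcTools2`): the lasso gain, with all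
binders explicit. [folklore] -/
theorem stub_tautLoopLlcTools2 :
    ∀ (v : EuclideanSpace ℝ (Fin 3) → EuclideanSpace ℝ (Fin 3)), ContDiff ℝ 2 v → ∀ (R₀ d w τ :
      ℝ), 0 < w → 0 < τ → ∃ G₀ : ℝ, 0 < G₀ ∧ ∀ γ : ℝ → EuclideanSpace ℝ (Fin 3),
      Literature.Analysis.FluidPDE.IsC1Loop γ → (∀ s : ℝ, ‖γ s‖ ≤ R₀) → ∀ (x : EuclideanSpace ℝ
      (Fin 3)) (s : ℝ), dist x (γ s) ≤ d → w ≤ ‖Literature.Analysis.FluidPDE.curl v x‖ → ∃ Λ :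
      ℝ → EuclideanSpace ℝ (Fin 3), Literature.Analysis.FluidPDE.IsC1Loop Λ ∧
      |Literature.Analysis.FluidPDE.circulation v γ| + G₀ ≤
      |Literature.Analysis.FluidPDE.circulation v Λ| ∧ (∫ σ in (0:ℝ)..1, ‖deriv Λ σ‖) ≤ (∫ σ in
      (0:ℝ)..1, ‖deriv γ σ‖) + Real.pi * d + τ :=
  fun _v hv R₀ d w τ hw hτ => tautLoopLlc_lasso_gain hv R₀ d w τ hw hτ

end Summit.NavierStokesRegularity.NavierStokesRegularity.Theorems

end
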